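import Literature.Probability.LatticeModels.GibbsSpecificationSummable
import Literature.Probability.LatticeModels.DobrushinMetricInfiniteRange
import Literature.Probability.LatticeModels.DobrushinTiltOscillation
import Literature.Probability.LatticeModels.DobrushinTiltSharp
import HarnessLib

/-!
# Dobrushin uniqueness for absolutely summable potentials at high temperature

[topic Probability/LatticeModels]

For an adapted potential `Φ = (Φ_B)_B` with an absolutely summable majorant `|Φ_B| ≤ b B`,
`∑_{B ∋ x} b B < ∞` (`Potential.HasSummableBound`, Friedli–Velenik 2017, (6.25)), the Gibbsian
specification `gibbsSpecOfSummablePotential ν Φ β` (a priori probability measure `ν`) has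
one-site laws `ν.tilted (s ↦ -β H_{x}(ω^{x ← s}))`; two boundary conditions that agree off a site
`y` change the interaction through `x` by at most `2 D_{xy}`, `D_{xy} := ∑_{B ∋ x, y} b B`, so by
the tilt oscillation bound (Georgii 2011, Prop. 8.8; tree
`DobrushinMetric.abs_integral_tilted_sub_integral_tilted_le`) the one-site total-variation
coefficient is at most `½ (e^{4|β| D_{xy}} − 1)`; the one-site laws are quasilocal (tails of the
summable majorant), so the sitewise legs sum to the global bound
(`DobrushinMetric.global_of_sitewise_of_quasilocal`), and Dobrushin's uniqueness theorem in the
infinite-range total-variation form (Friedli–Velenik 2017, Thm. 6.31; tree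
`DobrushinMetric.subsingleton_gibbsMeasures_of_summable_tv`) gives: if
`sup_x ∑_{y ≠ x} ½ (e^{4|β| D_{xy}} − 1) ≤ c < 1` then there is at most one Gibbs measure.

This is the EXPONENTIAL form of the high-temperature criterion
(`subsingleton_gibbsMeasures_gibbsSpecOfSummablePotential`). The LINEAR form (Simon, CMP 68 (1979)
183–185, Theorem: `∑_{X ∋ 0} (|X| − 1) ‖Φ(X)‖_∞ < 1` implies Dobrushin's condition, via the Lemma
`‖μ_h − μ_g‖ ≤ ‖h − g‖_∞`; Gross, Saint-Flour lectures (21.3); Georgii 2011, Prop. 8.8;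
Friedli–Velenik 2017, Thm. 6.35 / (6.46)–(6.47) / Cor. 6.37 with `β < 1/(2b)` in their un-halved
total-variation normalisation) follows from Simon's lemma in the tree
(`DobrushinMetric.abs_integral_tilted_sub_integral_tilted_le_linear`, file `DobrushinTiltSharp`):
the one-site coefficient is at most `|β| D_{xy}` (`abs_integral_siteLaw_sub_le_of_eq_off_linear`),
so `sup_x ∑_{y ≠ x} |β| D_{xy} ≤ c < 1` suffices
(`subsingleton_gibbsMeasures_gibbsSpecOfSummablePotential_linear`), and by the rearrangement
`∑_{y ≠ x} D_{xy} = ∑_{B ∋ x} (|B| − 1) b B` (Friedli–Velenik (6.47);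
`hasSum_pairMajorant_eq_card_sub_one`) this is SIMON'S THEOREM with the sup-norm majorant `b`:
`sup_x |β| ∑_{B ∋ x} (|B| − 1) b B ≤ c < 1` implies uniqueness
(`subsingleton_gibbsMeasures_gibbsSpecOfSummablePotential_simon`).
With OSCILLATION majorants `δ B ≥ sup |Φ_B(σ) − Φ_B(σ')|` (w.l.o.g. `δ B ≤ 2 b B`) the one-site
coefficient is at most `½ |β| ∑_{B ∋ x, y} δ B` (`abs_integral_siteLaw_sub_le_of_eq_off_osc`, by
centring the energy difference before Simon's lemma — Simon's Remarks 1–2), whence GEORGII'S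
PROP. 8.8: `sup_x ½ |β| ∑_{B ∋ x} (|B| − 1) δ B ≤ c < 1` implies uniqueness
(`subsingleton_gibbsMeasures_gibbsSpecOfSummablePotential_georgii`; Friedli–Velenik's Thm. 6.35 /
(6.46) asks `< 1` without the `½`, in their un-halved total-variation normalisation, and is implied).

## Main statements

* `DobrushinMetric.siteLaw_tilted_map_glueWith_pi`, `siteLaw_gibbsSpecOfSummablePotential` — the
  one-site law of a tilted product specification / of `gibbsSpecOfSummablePotential` is a tilt of
  the a priori measure.
* `abs_hamiltonianTsum_singleton_sub_le`, `abs_hamiltonianTsum_singleton_sub_le_tail` — one-site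
  and tail legs of the interaction through a site.
* `abs_integral_siteLaw_sub_le_of_eq_off` — the sitewise TV leg `½ (e^{4|β| D_{xy}} − 1) · osc`.
* `siteLaw_gibbsSpecOfSummablePotential_quasilocal` — quasilocality of the one-site laws.
* `subsingleton_gibbsMeasures_gibbsSpecOfSummablePotential` — uniqueness at high temperature
  (exponential form).
* `abs_integral_siteLaw_sub_le_of_eq_off_linear` — the sitewise TV leg `|β| D_{xy} · osc` (Simon).
* `subsingleton_gibbsMeasures_gibbsSpecOfSummablePotential_linear` — uniqueness under
  `sup_x ∑_{y ≠ x} |β| D_{xy} ≤ c < 1`.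
* `hasSum_pairMajorant_eq_card_sub_one` — `∑_{y ≠ x} D_{xy} = ∑_{B ∋ x} (|B| − 1) b B`.
* `subsingleton_gibbsMeasures_gibbsSpecOfSummablePotential_simon` — Simon's theorem:
  uniqueness under `sup_x |β| ∑_{B ∋ x} (|B| − 1) b B ≤ c < 1`.
* `abs_integral_siteLaw_sub_le_of_eq_off_osc`, `subsingleton_gibbsMeasures_gibbsSpecOfSummablePotential_osc`,
  `subsingleton_gibbsMeasures_gibbsSpecOfSummablePotential_georgii` — the oscillation forms
  (`½ |β| ∑_{B ∋ x, y} δ B`; Georgii Prop. 8.8: `sup_x ½ |β| ∑_{B ∋ x} (|B| − 1) δ B ≤ c < 1`).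

## References
* H.-O. Georgii, *Gibbs Measures and Phase Transitions*, 2nd ed., de Gruyter (2011), Prop. 8.8,
  Thm. 8.7, (2.11)–(2.12).
* S. Friedli, Y. Velenik, *Statistical Mechanics of Lattice Systems*, CUP (2017), Def. 6.14,
  (6.25), Thm. 6.31, Thm. 6.35.
* H. Föllmer, *Random fields and diffusion processes*, LNM 1362 (1988), Ch. I §2.1, Remark (2.17).
* B. Simon, *A remark on Dobrushin's uniqueness theorem*, Commun. Math. Phys. 68 (1979) 183–185,
  Lemma and Theorem (p. 184), Remarks 1–2 (p. 185).
* L. Gross, *Thermodynamics, Statistical Mechanics and Random Fields*, Saint-Flour X (1980), in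
  *Mathematical Physics at Saint-Flour*, Springer (2012), §21, (21.3).
-/

noncomputable section

open MeasureTheory

namespace Literature.Probability.LatticeModels

variable {V S : Type*} [DecidableEq V] [MeasurableSpace S]

/-- Push-forward commutes with tilting (a copy of the tree's `map_tilted_comp` in
`ONModelProofs`, kept private to keep the imports light). [folklore] -/
private theorem map_tilted_comp' {α γ : Type*} [MeasurableSpace α] [MeasurableSpace γ]
    (μ : Measure α) {Φ : α → γ} (hΦ : Measurable Φ) {g : γ → ℝ} (hg : Measurable g) :
    (μ.tilted (g ∘ Φ)).map Φ = (μ.map Φ).tilted g := by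
  refine Measure.ext fun s hs => ?_
  rw [Measure.map_apply hΦ hs, tilted_apply' _ _ (hΦ hs), tilted_apply' _ _ hs,
    integral_map hΦ.aemeasurable hg.exp.aestronglyMeasurable,
    setLIntegral_map hs (by fun_prop) hΦ]
  rfl

/-- **The one-site law of a tilted product specification** (Föllmer 1988, Ch. I §2.1,
`π_k(· | η)`): for the kernels `γ_Λ(· | η) = (ν^{⊗Λ} ∘ glueWith(·, η)⁻¹).tilted φ_Λ` with an a
priori probability measure `ν`, the law of the spin at `x` under `γ_{x}(· | ω)` is
`ν.tilted (s ↦ φ_{x}(ω^{x ← s}))` (push-forward commutes with tilting; `eval` pushes the one-fold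
product to `ν`). [cite: Follmer1988, Ch. I (2.1)] -/
theorem DobrushinMetric.siteLaw_tilted_map_glueWith_pi (ν : Measure S) [IsProbabilityMeasure ν]
    (φ : Finset V → (V → S) → ℝ) (x : V) (hφ : Measurable (φ {x})) (ω : V → S) :
    DobrushinMetric.siteLaw
        (fun Λ η => ((Measure.pi fun _ : ↥Λ => ν).map (glueWith Λ · η)).tilted (φ Λ)) x ω =
      ν.tilted fun s => φ {x} (Function.update ω x s) := by
  set π : (↥({x} : Finset V) → S) → S := fun ζ => ζ ⟨x, Finset.mem_singleton_self x⟩ with hπ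
  have hπm : Measurable π := measurable_pi_apply _
  have hglue : Measurable fun ζ : ↥({x} : Finset V) → S => glueWith {x} ζ ω :=
    measurable_glueWith _ ω
  have hF' : Measurable fun s : S => φ {x} (Function.update ω x s) := hφ.comp (measurable_update ω)
  have hgl : (fun ζ : ↥({x} : Finset V) → S => glueWith {x} ζ ω) = Function.update ω x ∘ π := by
    funext ζ z
    by_cases hz : z = x
    · subst hz
      simp [hπ]
    · rw [Function.comp_apply, Function.update_of_ne hz,
        glueWith_apply_not_mem _ _ _ (by simpa using hz)]
  have hcomp : φ {x} ∘ (fun ζ : ↥({x} : Finset V) → S => glueWith {x} ζ ω) =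
      (fun s : S => φ {x} (Function.update ω x s)) ∘ π := by
    rw [hgl]
    rfl
  have heval : (fun σ : V → S => σ x) ∘ (fun ζ : ↥({x} : Finset V) → S => glueWith {x} ζ ω) = π := by
    funext ζ
    simp [hπ]
  have hev : (Measure.pi fun _ : ↥({x} : Finset V) => ν).map π = ν :=
    (MeasureTheory.measurePreserving_eval (fun _ : ↥({x} : Finset V) => ν)
      ⟨x, Finset.mem_singleton_self x⟩).map_eq
  show (((Measure.pi fun _ : ↥({x} : Finset V) => ν).map (fun ζ => glueWith {x} ζ ω)).tilted
      (φ {x})).map (fun σ : V → S => σ x) = _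
  rw [← map_tilted_comp' _ hglue hφ, Measure.map_map (measurable_pi_apply x) hglue, heval, hcomp,
    map_tilted_comp' _ hπm hF', hev]

/-- **The one-site law of the specification of an absolutely summable potential** is the a
priori measure tilted by `-β H_{x}(ω^{x ← s})` (Friedli–Velenik 2017, (6.110) with Def. 6.14;
Föllmer 1988, Ch. I §2.1). [cite: FriedliVelenik2017, Def. 6.14] -/
theorem siteLaw_gibbsSpecOfSummablePotential [Countable V] (ν : Measure S) [IsProbabilityMeasure ν]
    {Φ : Potential V S} {b : Finset V → ℝ} (hΦ : Φ.IsAdapted) (hb : Φ.HasSummableBound b)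
    (β : ℝ) (x : V) (ω : V → S) :
    DobrushinMetric.siteLaw (gibbsSpecOfSummablePotential ν Φ β) x ω =
      ν.tilted fun s => -β * hamiltonianTsum Φ {x} (Function.update ω x s) := by
  unfold gibbsSpecOfSummablePotential
  exact DobrushinMetric.siteLaw_tilted_map_glueWith_pi ν (fun Λ σ => -β * hamiltonianTsum Φ Λ σ) x
    ((measurable_hamiltonianTsum (fun B => (hΦ B).2) hb {x}).const_mul _) ω

/-! ### The one-site leg of the interaction through `x` -/

section Leg

variable {Φ : Potential V S} {b : Finset V → ℝ}

omit [MeasurableSpace S] in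
/-- The pair majorant `D_{xy} = ∑_{B ∋ x, y} b B` converges under `HasSummableBound`
(Friedli–Velenik 2017, (6.25)). [cite: FriedliVelenik2017, eq. (6.25)] -/
theorem Potential.HasSummableBound.summable_pair [Nonempty (V → S)] (h : Φ.HasSummableBound b)
    (x y : V) : Summable fun B : Finset V => if x ∈ B ∧ y ∈ B then b B else 0 := by
  refine Summable.of_nonneg_of_le (fun B => ?_) (fun B => ?_) (h.summable x)
  · split_ifs
    exacts [h.nonneg B, le_rfl]
  · by_cases hx : x ∈ B <;> by_cases hy : y ∈ B <;> simp [hx, hy, h.nonneg B]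

/-- **One-site leg** (Georgii 2011, (2.11)–(2.12) / proof of Prop. 8.8): if `σ, σ'` agree off
`y`, the interactions through `x` differ by at most `2 D_{xy}`, `D_{xy} := ∑_{B ∋ x, y} b B`
(adaptedness kills every `B ∌ y`). [cite: Georgii2011, Prop. 8.8] -/
theorem abs_hamiltonianTsum_singleton_sub_le (hΦ : Φ.IsAdapted) (h : Φ.HasSummableBound b)
    (x y : V) {σ σ' : V → S} (hσ : ∀ z, z ≠ y → σ z = σ' z) :
    |hamiltonianTsum Φ {x} σ - hamiltonianTsum Φ {x} σ'| ≤
      2 * ∑' B : Finset V, if x ∈ B ∧ y ∈ B then b B else 0 := by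
  haveI : Nonempty (V → S) := ⟨σ⟩
  have hS := summable_hamiltonianTsum h {x} σ
  have hS' := summable_hamiltonianTsum h {x} σ'
  have hP := h.summable_pair x y
  unfold hamiltonianTsum
  rw [← hS.tsum_sub hS', ← tsum_mul_left]
  have hterm : ∀ B : Finset V,
      ‖(if (B ∩ {x}).Nonempty then Φ B σ else 0) - (if (B ∩ {x}).Nonempty then Φ B σ' else 0)‖ ≤
        2 * (if x ∈ B ∧ y ∈ B then b B else 0) := by
    intro B
    rw [Real.norm_eq_abs]
    have hxB : (B ∩ {x}).Nonempty ↔ x ∈ B := by simp [Finset.Nonempty]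
    by_cases hx : x ∈ B
    · rw [if_pos (hxB.2 hx), if_pos (hxB.2 hx)]
      by_cases hy : y ∈ B
      · rw [if_pos ⟨hx, hy⟩]
        calc |Φ B σ - Φ B σ'| ≤ |Φ B σ| + |Φ B σ'| := abs_sub _ _
          _ ≤ b B + b B := add_le_add (h.abs_le B σ) (h.abs_le B σ')
          _ = 2 * b B := by ring
      · rw [if_neg (fun h' => hy h'.2)]
        have : Φ B σ = Φ B σ' := (hΦ B).1 fun i hi => hσ i (by
          rintro rfl
          exact hy (Finset.mem_coe.1 hi))
        simp [this]
    · have hn : ¬ (B ∩ {x}).Nonempty := fun h' => hx (hxB.1 h')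
      rw [if_neg hn, if_neg hn, if_neg (fun h' => hx h'.1)]
      simp
  calc |∑' B : Finset V, ((if (B ∩ {x}).Nonempty then Φ B σ else 0) -
          (if (B ∩ {x}).Nonempty then Φ B σ' else 0))|
        = ‖∑' B : Finset V, ((if (B ∩ {x}).Nonempty then Φ B σ else 0) -
          (if (B ∩ {x}).Nonempty then Φ B σ' else 0))‖ := (Real.norm_eq_abs _).symm
    _ ≤ ∑' B : Finset V, ‖(if (B ∩ {x}).Nonempty then Φ B σ else 0) -
          (if (B ∩ {x}).Nonempty then Φ B σ' else 0)‖ := by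
        refine norm_tsum_le_tsum_norm ?_
        exact Summable.of_nonneg_of_le (fun _ => norm_nonneg _) hterm (hP.mul_left 2)
    _ ≤ ∑' B : Finset V, 2 * (if x ∈ B ∧ y ∈ B then b B else 0) :=
        Summable.tsum_le_tsum hterm
          (Summable.of_nonneg_of_le (fun _ => norm_nonneg _) hterm (hP.mul_left 2)) (hP.mul_left 2)

end Leg

/-! ### The sitewise total-variation leg via the tilt bound -/

section SiteLeg

variable {Φ : Potential V S} {b : Finset V → ℝ}

/-- **Sitewise leg for the one-site laws** (Georgii 2011, Prop. 8.8 — the exponential form): if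
`ω = η` off `y`, then for every bounded measurable `φ` of oscillation `≤ L`,
`|γ_x(φ | ω) − γ_x(φ | η)| ≤ ½ (e^{4|β| D_{xy}} − 1) L`. [cite: Georgii2011, Prop. 8.8] -/
theorem abs_integral_siteLaw_sub_le_of_eq_off [Countable V] (ν : Measure S)
    [IsProbabilityMeasure ν] (hΦ : Φ.IsAdapted) (hb : Φ.HasSummableBound b) (β : ℝ) (x y : V)
    {ω η : V → S} (hoff : ∀ z, z ≠ y → ω z = η z) {φ : S → ℝ} {L : ℝ} (hφm : Measurable φ)
    (hφb : ∃ M, ∀ s, |φ s| ≤ M) (hφ : ∀ a c, |φ a - φ c| ≤ L) :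
    |∫ s, φ s ∂(DobrushinMetric.siteLaw (gibbsSpecOfSummablePotential ν Φ β) x ω) -
        ∫ s, φ s ∂(DobrushinMetric.siteLaw (gibbsSpecOfSummablePotential ν Φ β) x η)| ≤
      (Real.exp (2 * (2 * |β| * ∑' B : Finset V, if x ∈ B ∧ y ∈ B then b B else 0)) - 1) / 2 *
        L := by
  rw [siteLaw_gibbsSpecOfSummablePotential ν hΦ hb β x ω,
    siteLaw_gibbsSpecOfSummablePotential ν hΦ hb β x η]
  have hHm : Measurable (hamiltonianTsum Φ {x}) :=
    measurable_hamiltonianTsum (fun B => (hΦ B).2) hb {x}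
  have hm : ∀ ζ : V → S, Measurable fun s : S => -β * hamiltonianTsum Φ {x} (Function.update ζ x s) :=
    fun ζ => (hHm.comp (measurable_update ζ)).const_mul _
  have hbd : ∀ ζ : V → S, ∃ B, ∀ s : S, |-β * hamiltonianTsum Φ {x} (Function.update ζ x s)| ≤ B := by
    intro ζ
    refine ⟨|β| * ∑' B : Finset V, (if (B ∩ {x}).Nonempty then b B else 0), fun s => ?_⟩
    rw [abs_mul, abs_neg]
    exact mul_le_mul_of_nonneg_left (abs_hamiltonianTsum_le hb {x} _) (abs_nonneg β)
  refine DobrushinMetric.abs_integral_tilted_sub_integral_tilted_le ν (hm ω) (hm η) (hbd ω) (hbd η)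
    (κ := 0) (fun s => ?_) hφm hφb hφ
  rw [sub_zero, ← mul_sub, abs_mul, abs_neg, mul_comm (2 : ℝ) |β|, mul_assoc]
  refine mul_le_mul_of_nonneg_left ?_ (abs_nonneg β)
  refine abs_hamiltonianTsum_singleton_sub_le hΦ hb x y fun z hz => ?_
  by_cases hzx : z = x
  · subst hzx
    simp
  · rw [Function.update_of_ne hzx, Function.update_of_ne hzx, hoff z hz]

end SiteLeg

/-! ### Quasilocality of the one-site laws -/

section Quasilocal

variable {Φ : Potential V S} {b : Finset V → ℝ}

/-- **Tail leg**: if `σ, σ'` agree on every member of the finite family `F`, the interactions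
through `x` differ by at most twice the tail `∑_{B ∉ F, B ∋ x} b B` (Friedli–Velenik 2017, proof of
Lemma 6.15 / (6.25); Georgii 2011, (2.11)–(2.12)). [cite: FriedliVelenik2017, Lemma 6.15] -/
theorem abs_hamiltonianTsum_singleton_sub_le_tail (hΦ : Φ.IsAdapted) (h : Φ.HasSummableBound b)
    (x : V) (F : Finset (Finset V)) {σ σ' : V → S} (hσ : ∀ B ∈ F, ∀ z ∈ B, σ z = σ' z) :
    |hamiltonianTsum Φ {x} σ - hamiltonianTsum Φ {x} σ'| ≤
      2 * ∑' B : Finset V, ((↑F : Set (Finset V))ᶜ).indicator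
        (fun B => if x ∈ B then b B else 0) B := by
  haveI : Nonempty (V → S) := ⟨σ⟩
  have hS := summable_hamiltonianTsum h {x} σ
  have hS' := summable_hamiltonianTsum h {x} σ'
  have hg0 : ∀ B : Finset V, 0 ≤ (if x ∈ B then b B else 0) := fun B => by
    split_ifs
    exacts [h.nonneg B, le_rfl]
  have hP : Summable fun B : Finset V => ((↑F : Set (Finset V))ᶜ).indicator
      (fun B => if x ∈ B then b B else 0) B :=
    (h.summable x).indicator _
  unfold hamiltonianTsum
  rw [← hS.tsum_sub hS', ← tsum_mul_left]
  have hxB : ∀ B : Finset V, (B ∩ {x}).Nonempty ↔ x ∈ B := fun B => by simp [Finset.Nonempty]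
  have hterm : ∀ B : Finset V,
      ‖(if (B ∩ {x}).Nonempty then Φ B σ else 0) - (if (B ∩ {x}).Nonempty then Φ B σ' else 0)‖ ≤
        2 * ((↑F : Set (Finset V))ᶜ).indicator (fun B => if x ∈ B then b B else 0) B := by
    intro B
    rw [Real.norm_eq_abs]
    by_cases hBF : B ∈ F
    · have : Φ B σ = Φ B σ' := (hΦ B).1 fun i hi => hσ B hBF i (Finset.mem_coe.1 hi)
      rw [this, sub_self, abs_zero]
      exact mul_nonneg two_pos.le (Set.indicator_nonneg (fun B _ => hg0 B) _)
    · rw [Set.indicator_of_mem (show B ∈ (↑F : Set (Finset V))ᶜ by simpa using hBF)]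
      by_cases hx : x ∈ B
      · rw [if_pos ((hxB B).2 hx), if_pos ((hxB B).2 hx), if_pos hx]
        calc |Φ B σ - Φ B σ'| ≤ |Φ B σ| + |Φ B σ'| := abs_sub _ _
          _ ≤ b B + b B := add_le_add (h.abs_le B σ) (h.abs_le B σ')
          _ = 2 * b B := by ring
      · have hn : ¬ (B ∩ {x}).Nonempty := fun h' => hx ((hxB B).1 h')
        rw [if_neg hn, if_neg hn, if_neg hx]
        simp
  have hsum : Summable fun B : Finset V =>
      ‖(if (B ∩ {x}).Nonempty then Φ B σ else 0) - (if (B ∩ {x}).Nonempty then Φ B σ' else 0)‖ :=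
    Summable.of_nonneg_of_le (fun _ => norm_nonneg _) hterm (hP.mul_left 2)
  calc |∑' B : Finset V, ((if (B ∩ {x}).Nonempty then Φ B σ else 0) -
          (if (B ∩ {x}).Nonempty then Φ B σ' else 0))|
        = ‖∑' B : Finset V, ((if (B ∩ {x}).Nonempty then Φ B σ else 0) -
          (if (B ∩ {x}).Nonempty then Φ B σ' else 0))‖ := (Real.norm_eq_abs _).symm
    _ ≤ _ := norm_tsum_le_tsum_norm hsum
    _ ≤ _ := Summable.tsum_le_tsum hterm hsum (hP.mul_left 2)

open scoped Classical in
/-- **Quasilocality of the one-site laws of an absolutely summable potential** (Friedli–Velenik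
2017, §6.10.1 with Lemma 6.15: Gibbsian specifications of absolutely summable potentials are
quasilocal; Georgii 2011, (2.11)–(2.12)): the one-site kernels are continuous in the boundary
condition, uniformly over observables of bounded oscillation — the `hql` hypothesis of
`DobrushinMetric.global_of_sitewise_of_quasilocal` for the discrete weight.
[cite: FriedliVelenik2017, Lemma 6.15] -/
theorem siteLaw_gibbsSpecOfSummablePotential_quasilocal [Countable V] (ν : Measure S)
    [IsProbabilityMeasure ν] (hΦ : Φ.IsAdapted) (hb : Φ.HasSummableBound b) (β : ℝ) (x : V)
    (M L ε : ℝ) (hε : 0 < ε) :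
    ∃ Λ : Finset V, ∀ ω η : V → S, (∀ z ∈ Λ, ω z = η z) →
      ∀ φ : S → ℝ, Measurable φ → (∀ s, |φ s| ≤ M) →
        (∀ a c, |φ a - φ c| ≤ L * (if a = c then (0 : ℝ) else 1)) →
        |∫ s, φ s ∂(DobrushinMetric.siteLaw (gibbsSpecOfSummablePotential ν Φ β) x ω) -
            ∫ s, φ s ∂(DobrushinMetric.siteLaw (gibbsSpecOfSummablePotential ν Φ β) x η)| ≤ ε := by
  classical
  set g : Finset V → ℝ := fun B => if x ∈ B then b B else 0 with hg
  -- the rate function `t ↦ ½ (e^{4|β| t} − 1) L⁺` is continuous at `0` with value `0`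
  set L' : ℝ := max L 0 with hL'
  have hL'0 : 0 ≤ L' := le_max_right _ _
  have hcont : ContinuousAt (fun t : ℝ => (Real.exp (2 * (|β| * (2 * t))) - 1) / 2 * L') 0 := by
    fun_prop
  obtain ⟨δ₀, hδ₀, hδ⟩ := Metric.continuousAt_iff.1 hcont ε hε
  -- a finite family of interaction sets carrying all but `< δ₀/2` of the majorant through `x`
  have htail := tendsto_tsum_compl_atTop_zero g
  obtain ⟨F, hF⟩ := (htail.eventually (gt_mem_nhds (half_pos hδ₀))).exists
  have hFt : ∑' B : Finset V, ((↑F : Set (Finset V))ᶜ).indicator g B < δ₀ / 2 := by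
    rw [← tsum_subtype]
    exact hF
  refine ⟨F.biUnion id, fun ω η hωη φ hφm hφM hφ => ?_⟩
  -- oscillation of `φ` is at most `L⁺`
  have hφ' : ∀ a c, |φ a - φ c| ≤ L' := fun a c => by
    by_cases hac : a = c
    · subst hac
      simp [hL'0]
    · exact ((hφ a c).trans (by simp [hac])).trans (le_max_left _ _)
  rw [siteLaw_gibbsSpecOfSummablePotential ν hΦ hb β x ω,
    siteLaw_gibbsSpecOfSummablePotential ν hΦ hb β x η]
  have hHm : Measurable (hamiltonianTsum Φ {x}) :=
    measurable_hamiltonianTsum (fun B => (hΦ B).2) hb {x}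
  have hm : ∀ ζ : V → S, Measurable fun s : S => -β * hamiltonianTsum Φ {x} (Function.update ζ x s) :=
    fun ζ => (hHm.comp (measurable_update ζ)).const_mul _
  have hbd : ∀ ζ : V → S, ∃ B, ∀ s : S, |-β * hamiltonianTsum Φ {x} (Function.update ζ x s)| ≤ B := by
    intro ζ
    refine ⟨|β| * ∑' B : Finset V, (if (B ∩ {x}).Nonempty then b B else 0), fun s => ?_⟩
    rw [abs_mul, abs_neg]
    exact mul_le_mul_of_nonneg_left (abs_hamiltonianTsum_le hb {x} _) (abs_nonneg β)
  set t : ℝ := ∑' B : Finset V, ((↑F : Set (Finset V))ᶜ).indicator g B with ht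
  have ht0 : 0 ≤ t := by
    haveI : Nonempty (V → S) := ⟨ω⟩
    refine tsum_nonneg fun B => Set.indicator_nonneg (fun B _ => ?_) _
    simp only [hg]
    split_ifs
    exacts [hb.nonneg B, le_rfl]
  have key := DobrushinMetric.abs_integral_tilted_sub_integral_tilted_le ν (hm ω) (hm η) (hbd ω)
    (hbd η) (κ := 0) (ε := |β| * (2 * t)) (fun s => ?_) hφm ⟨M, hφM⟩ hφ'
  · refine key.trans ?_
    have := hδ (x := t) (by
      rw [dist_zero_right, Real.norm_eq_abs, abs_of_nonneg ht0]
      linarith)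
    simp only [mul_zero, Real.exp_zero, sub_self, zero_div, zero_mul, dist_zero_right,
      Real.norm_eq_abs] at this
    exact (le_abs_self _).trans this.le
  · rw [sub_zero, ← mul_sub, abs_mul, abs_neg]
    refine mul_le_mul_of_nonneg_left ?_ (abs_nonneg β)
    refine abs_hamiltonianTsum_singleton_sub_le_tail hΦ hb x F fun B hB z hz => ?_
    by_cases hzx : z = x
    · subst hzx
      simp
    · rw [Function.update_of_ne hzx, Function.update_of_ne hzx]
      exact hωη z (Finset.mem_biUnion.2 ⟨B, hB, hz⟩)

end Quasilocal

/-! ### Dobrushin uniqueness at high temperature -/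

section Uniqueness

variable {Φ : Potential V S} {b : Finset V → ℝ}

open scoped Classical in
/-- **Dobrushin uniqueness for an absolutely summable potential at high temperature**
(Georgii 2011, Prop. 8.8 with Thm. 8.7; Simon 1993, §V.1; Friedli–Velenik 2017, Thm. 6.31 — the
exponential form of the pair-interaction criterion): if
`sup_x ∑_{y ≠ x} ½ (e^{4|β| D_{xy}} − 1) ≤ c < 1`, `D_{xy} := ∑_{B ∋ x, y} b B`, then the
Gibbsian specification of `Φ` at inverse temperature `β` (a priori probability measure `ν` on a
spin space of bounded diameter) admits at most one Gibbs measure. The exponential (Prop. 8.8)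
form; NOT Friedli–Velenik (6.46)'s linear bound. [cite: Georgii2011, Prop. 8.8] -/
theorem subsingleton_gibbsMeasures_gibbsSpecOfSummablePotential [Countable V]
    [MeasurableSingletonClass S] [PseudoMetricSpace S] [BorelSpace S] [Nonempty S]
    (ν : Measure S) [IsProbabilityMeasure ν] (hΦ : Φ.IsAdapted) (hb : Φ.HasSummableBound b)
    (β : ℝ) {A : ℝ} (hA0 : 0 ≤ A) (hA : ∀ a c : S, dist a c ≤ A) (D : V → V → ℝ)
    (hD : ∀ x y, HasSum (fun B : Finset V => if x ∈ B ∧ y ∈ B then b B else 0) (D x y))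
    {c : ℝ} (hc0 : 0 ≤ c) (hc1 : c < 1)
    (hs : ∀ x, Summable fun y => if y = x then (0 : ℝ) else (Real.exp (4 * |β| * D x y) - 1) / 2)
    (hrow : ∀ x, ∑' y, (if y = x then (0 : ℝ) else (Real.exp (4 * |β| * D x y) - 1) / 2) ≤ c) :
    (gibbsMeasures (gibbsSpecOfSummablePotential ν Φ β)).Subsingleton := by
  have hγ := isSpecification_gibbsSpecOfSummablePotential ν hΦ hb β
  haveI : Nonempty (V → S) := ⟨fun _ => Classical.arbitrary S⟩
  have hD0 : ∀ x y, 0 ≤ D x y := fun x y =>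
    (hD x y).nonneg fun B => by
      split_ifs
      exacts [hb.nonneg B, le_rfl]
  have hDeq : ∀ x y, ∑' B : Finset V, (if x ∈ B ∧ y ∈ B then b B else 0) = D x y :=
    fun x y => (hD x y).tsum_eq
  set C : V → V → ℝ := fun x y => if y = x then (0 : ℝ) else (Real.exp (4 * |β| * D x y) - 1) / 2
    with hC
  have hC0 : ∀ x y, 0 ≤ C x y := fun x y => by
    simp only [hC]
    split_ifs
    · exact le_rfl
    · refine div_nonneg (sub_nonneg.2 (Real.one_le_exp ?_)) two_pos.le
      exact mul_nonneg (mul_nonneg (by norm_num) (abs_nonneg β)) (hD0 x y)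
  refine DobrushinMetric.subsingleton_gibbsMeasures_of_summable_tv hγ hA0 hA hC0 hs
    (fun x ω η φ L hφm hφb hL hφ => ?_) hc0 hc1 hrow
  -- the global bound from the one-site legs and quasilocality
  refine DobrushinMetric.global_of_sitewise_of_quasilocal
    (r := fun a c : S => if a = c then (0 : ℝ) else 1) (R := 1)
    (fun a c => by split_ifs <;> norm_num) (fun a c => by split_ifs <;> norm_num) hC0 hs x
    (fun y ω' η' hoff ψ L' hψm hψb hL' hψ => ?_)
    (fun M L' ε hε => siteLaw_gibbsSpecOfSummablePotential_quasilocal ν hΦ hb β x M L' ε hε)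
    ω η φ L hφm hφb hL (fun a c => by
      by_cases hac : a = c
      · subst hac; simp
      · simpa [hac] using hφ a c)
  -- the one-site leg at `y`
  have hψ' : ∀ a c, |ψ a - ψ c| ≤ L' := fun a c => by
    by_cases hac : a = c
    · subst hac; simp [hL']
    · simpa [hac] using hψ a c
  by_cases hωη : ω' y = η' y
  · -- then `ω' = η'`
    have : ω' = η' := funext fun z => by
      by_cases hz : z = y
      · subst hz; exact hωη
      · exact hoff z hz
    subst this
    simp
  rw [if_neg hωη, mul_one]
  by_cases hyx : y = x
  · subst hyx
    rw [DobrushinMetric.siteLaw_congr_of_eq_off' hγ y hoff, sub_self, abs_zero]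
    exact mul_nonneg (hC0 y y) hL'
  · have hleg := abs_integral_siteLaw_sub_le_of_eq_off ν hΦ hb β x y hoff hψm hψb hψ'
    rw [hDeq x y] at hleg
    have hCxy : C x y = (Real.exp (4 * |β| * D x y) - 1) / 2 := by simp [hC, hyx]
    rw [hCxy]
    convert hleg using 3
    ring_nf

end Uniqueness

/-! ### The linear (Simon / Georgii / Friedli–Velenik) high-temperature criterion -/

section Linear

variable {Φ : Potential V S} {b : Finset V → ℝ}

/-- **Sitewise leg for the one-site laws, linear form** (Simon 1979, proof of the Theorem, p. 184:
(5)–(6) `‖H(·|t) − H(·|t')‖_∞ ≤ 2 ∑_{X ⊃ {0,i}} ‖Φ(X)‖_∞` fed into the Lemma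
`‖μ_h − μ_g‖ ≤ ‖h − g‖_∞`): if `ω = η` off `y`, then for every bounded measurable `φ` of
oscillation `≤ L`, `|γ_x(φ | ω) − γ_x(φ | η)| ≤ |β| D_{xy} · L`, `D_{xy} = ∑_{B ∋ x, y} b B` — to be
compared with the exponential `½ (e^{4|β| D_{xy}} − 1) · L` of `abs_integral_siteLaw_sub_le_of_eq_off`.
[cite: Simon1979Dobrushin, Theorem (proof, (5)–(6))] -/
theorem abs_integral_siteLaw_sub_le_of_eq_off_linear [Countable V] (ν : Measure S)
    [IsProbabilityMeasure ν] (hΦ : Φ.IsAdapted) (hb : Φ.HasSummableBound b) (β : ℝ) (x y : V)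
    {ω η : V → S} (hoff : ∀ z, z ≠ y → ω z = η z) {φ : S → ℝ} {L : ℝ} (hφm : Measurable φ)
    (hφb : ∃ M, ∀ s, |φ s| ≤ M) (hφ : ∀ a c, |φ a - φ c| ≤ L) :
    |∫ s, φ s ∂(DobrushinMetric.siteLaw (gibbsSpecOfSummablePotential ν Φ β) x ω) -
        ∫ s, φ s ∂(DobrushinMetric.siteLaw (gibbsSpecOfSummablePotential ν Φ β) x η)| ≤
      (|β| * ∑' B : Finset V, if x ∈ B ∧ y ∈ B then b B else 0) * L := by
  rw [siteLaw_gibbsSpecOfSummablePotential ν hΦ hb β x ω,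
    siteLaw_gibbsSpecOfSummablePotential ν hΦ hb β x η]
  have hHm : Measurable (hamiltonianTsum Φ {x}) :=
    measurable_hamiltonianTsum (fun B => (hΦ B).2) hb {x}
  have hm : ∀ ζ : V → S, Measurable fun s : S => -β * hamiltonianTsum Φ {x} (Function.update ζ x s) :=
    fun ζ => (hHm.comp (measurable_update ζ)).const_mul _
  have hbd : ∀ ζ : V → S, ∃ B, ∀ s : S, |-β * hamiltonianTsum Φ {x} (Function.update ζ x s)| ≤ B := by
    intro ζ
    refine ⟨|β| * ∑' B : Finset V, (if (B ∩ {x}).Nonempty then b B else 0), fun s => ?_⟩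
    rw [abs_mul, abs_neg]
    exact mul_le_mul_of_nonneg_left (abs_hamiltonianTsum_le hb {x} _) (abs_nonneg β)
  have key := DobrushinMetric.abs_integral_tilted_sub_integral_tilted_le_linear ν (hm ω) (hm η)
    (hbd ω) (hbd η) (κ := 0)
    (ε := 2 * (|β| * ∑' B : Finset V, if x ∈ B ∧ y ∈ B then b B else 0)) (fun s => ?_) hφm hφb hφ
  · refine key.trans_eq ?_
    ring
  · rw [sub_zero, ← mul_sub, abs_mul, abs_neg, mul_left_comm]
    refine mul_le_mul_of_nonneg_left ?_ (abs_nonneg β)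
    refine abs_hamiltonianTsum_singleton_sub_le hΦ hb x y fun z hz => ?_
    by_cases hzx : z = x
    · subst hzx
      simp
    · rw [Function.update_of_ne hzx, Function.update_of_ne hzx, hoff z hz]

open scoped Classical in
/-- **Dobrushin uniqueness at high temperature, linear form** (Simon 1979, Theorem with Lemma;
Georgii 2011, Prop. 8.8; Friedli–Velenik 2017, Thm. 6.35 — here with the sup-norm majorant `b` of
`Potential.HasSummableBound`): if `sup_x ∑_{y ≠ x} |β| D_{xy} ≤ c < 1`, `D_{xy} := ∑_{B ∋ x, y} b B`,
then the Gibbsian specification of `Φ` at inverse temperature `β` (a priori probability measure `ν`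
on a spin space of bounded diameter) admits at most one Gibbs measure.
[cite: Simon1979Dobrushin, Theorem] -/
theorem subsingleton_gibbsMeasures_gibbsSpecOfSummablePotential_linear [Countable V]
    [MeasurableSingletonClass S] [PseudoMetricSpace S] [BorelSpace S] [Nonempty S]
    (ν : Measure S) [IsProbabilityMeasure ν] (hΦ : Φ.IsAdapted) (hb : Φ.HasSummableBound b)
    (β : ℝ) {A : ℝ} (hA0 : 0 ≤ A) (hA : ∀ a c : S, dist a c ≤ A) (D : V → V → ℝ)
    (hD : ∀ x y, HasSum (fun B : Finset V => if x ∈ B ∧ y ∈ B then b B else 0) (D x y))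
    {c : ℝ} (hc0 : 0 ≤ c) (hc1 : c < 1)
    (hs : ∀ x, Summable fun y => if y = x then (0 : ℝ) else |β| * D x y)
    (hrow : ∀ x, ∑' y, (if y = x then (0 : ℝ) else |β| * D x y) ≤ c) :
    (gibbsMeasures (gibbsSpecOfSummablePotential ν Φ β)).Subsingleton := by
  have hγ := isSpecification_gibbsSpecOfSummablePotential ν hΦ hb β
  haveI : Nonempty (V → S) := ⟨fun _ => Classical.arbitrary S⟩
  have hD0 : ∀ x y, 0 ≤ D x y := fun x y =>
    (hD x y).nonneg fun B => by
      split_ifs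
      exacts [hb.nonneg B, le_rfl]
  have hDeq : ∀ x y, ∑' B : Finset V, (if x ∈ B ∧ y ∈ B then b B else 0) = D x y :=
    fun x y => (hD x y).tsum_eq
  set C : V → V → ℝ := fun x y => if y = x then (0 : ℝ) else |β| * D x y with hC
  have hC0 : ∀ x y, 0 ≤ C x y := fun x y => by
    simp only [hC]
    split_ifs
    · exact le_rfl
    · exact mul_nonneg (abs_nonneg β) (hD0 x y)
  refine DobrushinMetric.subsingleton_gibbsMeasures_of_summable_tv hγ hA0 hA hC0 hs
    (fun x ω η φ L hφm hφb hL hφ => ?_) hc0 hc1 hrow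
  -- the global bound from the one-site legs and quasilocality
  refine DobrushinMetric.global_of_sitewise_of_quasilocal
    (r := fun a c : S => if a = c then (0 : ℝ) else 1) (R := 1)
    (fun a c => by split_ifs <;> norm_num) (fun a c => by split_ifs <;> norm_num) hC0 hs x
    (fun y ω' η' hoff ψ L' hψm hψb hL' hψ => ?_)
    (fun M L' ε hε => siteLaw_gibbsSpecOfSummablePotential_quasilocal ν hΦ hb β x M L' ε hε)
    ω η φ L hφm hφb hL (fun a c => by
      by_cases hac : a = c
      · subst hac; simp
      · simpa [hac] using hφ a c)
  -- the one-site leg at `y`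
  have hψ' : ∀ a c, |ψ a - ψ c| ≤ L' := fun a c => by
    by_cases hac : a = c
    · subst hac; simp [hL']
    · simpa [hac] using hψ a c
  by_cases hωη : ω' y = η' y
  · -- then `ω' = η'`
    have : ω' = η' := funext fun z => by
      by_cases hz : z = y
      · subst hz; exact hωη
      · exact hoff z hz
    subst this
    simp
  rw [if_neg hωη, mul_one]
  by_cases hyx : y = x
  · subst hyx
    rw [DobrushinMetric.siteLaw_congr_of_eq_off' hγ y hoff, sub_self, abs_zero]
    exact mul_nonneg (hC0 y y) hL'
  · have hleg := abs_integral_siteLaw_sub_le_of_eq_off_linear ν hΦ hb β x y hoff hψm hψb hψ'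
    rw [hDeq x y] at hleg
    have hCxy : C x y = |β| * D x y := by simp [hC, hyx]
    rw [hCxy]
    exact hleg

omit [MeasurableSpace S] in
/-- **The rearrangement (6.47)** (Friedli–Velenik 2017, (6.47); Simon 1979, end of the proof of the
Theorem, p. 184: `∑_i ∑_{X ⊃ {0,i}} ‖Φ(X)‖_∞ = ∑_{X ∋ 0} (|X| − 1) ‖Φ(X)‖_∞`): for a nonnegative
`b` with `∑_{B ∋ x} (|B| − 1) b B` convergent, the pair majorant `D_{xy} = ∑_{B ∋ x, y} b B`
summed over `y ≠ x` has the same value (Fubini for nonnegative families).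
[cite: FriedliVelenik2017, eq. (6.47)] -/
theorem hasSum_pairMajorant_eq_card_sub_one (hb0 : ∀ B : Finset V, 0 ≤ b B) (x : V) {K : ℝ}
    (hK : HasSum (fun B : Finset V => if x ∈ B then ((B.card : ℝ) - 1) * b B else 0) K) :
    HasSum (fun y : V => if y = x then (0 : ℝ)
      else ∑' B : Finset V, if x ∈ B ∧ y ∈ B then b B else 0) K := by
  classical
  -- the nonnegative family on `Finset V × V`
  set f : Finset V × V → ℝ := fun p => if x ∈ p.1 ∧ p.2 ∈ p.1 ∧ p.2 ≠ x then b p.1 else 0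
    with hf
  have hf0 : 0 ≤ f := fun p => by
    simp only [hf]
    split_ifs
    exacts [hb0 _, le_rfl]
  -- fibres over `B`: finite support, value `(|B| − 1) b B`
  have hfB : ∀ B : Finset V, ∀ y ∉ B, f (B, y) = 0 := fun B y hy => by
    simp only [hf]
    rw [if_neg]
    exact fun h => hy h.2.1
  have hsB : ∀ B : Finset V, Summable fun y => f (B, y) := fun B =>
    summable_of_ne_finset_zero (hfB B)
  have htB : ∀ B : Finset V, ∑' y, f (B, y) = if x ∈ B then ((B.card : ℝ) - 1) * b B else 0 := by
    intro B
    rw [tsum_eq_sum (s := B) (fun y hy => hfB B y hy)]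
    by_cases hx : x ∈ B
    · rw [if_pos hx]
      have : ∀ y ∈ B, f (B, y) = if y ≠ x then b B else 0 := fun y hy => by
        simp only [hf, hx, hy, true_and]
      rw [Finset.sum_congr rfl this, Finset.sum_ite, Finset.sum_const_zero, add_zero,
        Finset.sum_const, nsmul_eq_mul, Finset.filter_ne' B x, Finset.card_erase_of_mem hx,
        Nat.cast_sub (Finset.card_pos.2 ⟨x, hx⟩), Nat.cast_one]
    · rw [if_neg hx]
      exact Finset.sum_eq_zero fun y _ => by simp [hf, hx]
  have hsum : Summable f :=
    (summable_prod_of_nonneg hf0).2 ⟨hsB, by simp_rw [htB]; exact hK.summable⟩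
  have htot : ∑' p, f p = K := by
    rw [hsum.tsum_prod' hsB]
    simp_rw [htB]
    exact hK.tsum_eq
  -- swap the factors and sum fibrewise over `y`
  have hswap : Summable fun p : V × Finset V => f p.swap := hsum.prod_symm
  have htot' : ∑' p : V × Finset V, f p.swap = K := by
    rw [← htot]
    exact (Equiv.prodComm V (Finset V)).tsum_eq f
  have hfib : ∀ y : V, HasSum (fun B : Finset V => f (B, y))
      (if y = x then (0 : ℝ) else ∑' B : Finset V, if x ∈ B ∧ y ∈ B then b B else 0) := by
    intro y
    by_cases hyx : y = x
    · subst hyx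
      rw [if_pos rfl]
      have : (fun B : Finset V => f (B, y)) = fun _ => 0 := funext fun B => by simp [hf]
      rw [this]
      exact hasSum_zero
    · rw [if_neg hyx]
      have hfy : (fun B : Finset V => f (B, y)) = fun B => if x ∈ B ∧ y ∈ B then b B else 0 :=
        funext fun B => by simp [hf, hyx]
      have hsy : Summable fun B : Finset V => f (B, y) := by
        simpa using hswap.prod_factor y
      rw [hfy] at hsy ⊢
      exact hsy.hasSum
  have hF : HasSum (fun p : V × Finset V => f p.swap) K := htot' ▸ hswap.hasSum
  exact hF.prod_fiberwise fun y => by simpa using hfib y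

open scoped Classical in
/-- **Simon's high-temperature uniqueness theorem** (Simon 1979, Theorem, p. 184 — as quoted by
Gross, Saint-Flour lectures §21, (21.3): `∑_{A ∋ 0} (|A| − 1) sup |Φ(A)| < 1` implies Dobrushin's
condition `α < 1`; Friedli–Velenik 2017, Cor. 6.37 prints `β < 1/(2b)` in their un-halved
normalisation): for an adapted potential with a summable sup-norm majorant `b` (`|Φ_B| ≤ b B`) on a
spin space of bounded diameter, if `sup_x |β| ∑_{B ∋ x} (|B| − 1) b B ≤ c < 1` then
`gibbsSpecOfSummablePotential ν Φ β` admits at most one Gibbs measure.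
[cite: Simon1979Dobrushin, Theorem] -/
theorem subsingleton_gibbsMeasures_gibbsSpecOfSummablePotential_simon [Countable V]
    [MeasurableSingletonClass S] [PseudoMetricSpace S] [BorelSpace S] [Nonempty S]
    (ν : Measure S) [IsProbabilityMeasure ν] (hΦ : Φ.IsAdapted) (hb : Φ.HasSummableBound b)
    (β : ℝ) {A : ℝ} (hA0 : 0 ≤ A) (hA : ∀ a c : S, dist a c ≤ A) (K : V → ℝ)
    (hK : ∀ x, HasSum (fun B : Finset V => if x ∈ B then ((B.card : ℝ) - 1) * b B else 0) (K x))
    {c : ℝ} (hc0 : 0 ≤ c) (hc1 : c < 1) (hrow : ∀ x, |β| * K x ≤ c) :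
    (gibbsMeasures (gibbsSpecOfSummablePotential ν Φ β)).Subsingleton := by
  haveI : Nonempty (V → S) := ⟨fun _ => Classical.arbitrary S⟩
  set D : V → V → ℝ := fun x y => ∑' B : Finset V, if x ∈ B ∧ y ∈ B then b B else 0 with hDdef
  have hD : ∀ x y, HasSum (fun B : Finset V => if x ∈ B ∧ y ∈ B then b B else 0) (D x y) :=
    fun x y => (hb.summable_pair x y).hasSum
  have hpair : ∀ x, HasSum (fun y : V => if y = x then (0 : ℝ) else D x y) (K x) :=
    fun x => hasSum_pairMajorant_eq_card_sub_one (fun B => hb.nonneg B) x (hK x)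
  have hpairβ : ∀ x, HasSum (fun y : V => if y = x then (0 : ℝ) else |β| * D x y) (|β| * K x) := by
    intro x
    have h := (hpair x).mul_left |β|
    simp only [mul_ite, mul_zero] at h
    exact h
  exact subsingleton_gibbsMeasures_gibbsSpecOfSummablePotential_linear ν hΦ hb β hA0 hA D hD hc0
    hc1 (fun x => (hpairβ x).summable) (fun x => by rw [(hpairβ x).tsum_eq]; exact hrow x)

end Linear

/-! ### Oscillation majorants (Simon 1979 Remarks 1–2 / Georgii (8.8) / Friedli–Velenik (6.46)) -/

section Oscillation

variable {Φ : Potential V S} {b δ : Finset V → ℝ}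

/-- **Four-point leg** (Simon 1979, Remark 2 p. 185 applied to the proof of the Theorem, (5); Friedli–
Velenik 2017, proof of Thm. 6.35: `|ΔH_i(η_i) − ΔH_i(η_i')| ≤ 2 ∑_{B ⊃ {i,j}} δ(Φ_B)`): if
`σ₁ = σ₂` off `y` and `σ₃ = σ₄` off `y`, and `δ B` bounds the oscillation of `Φ_B`, then
`|(H_x σ₁ − H_x σ₂) − (H_x σ₃ − H_x σ₄)| ≤ 2 ∑_{B ∋ x, y} δ B`.
[cite: FriedliVelenik2017, Thm. 6.35 (proof)] -/
theorem abs_hamiltonianTsum_singleton_sub_sub_le (hΦ : Φ.IsAdapted) (h : Φ.HasSummableBound b)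
    (hδ : ∀ B σ σ', |Φ B σ - Φ B σ'| ≤ δ B) (hδb : ∀ B, δ B ≤ 2 * b B) (x y : V)
    {σ₁ σ₂ σ₃ σ₄ : V → S} (h12 : ∀ z, z ≠ y → σ₁ z = σ₂ z) (h34 : ∀ z, z ≠ y → σ₃ z = σ₄ z) :
    |(hamiltonianTsum Φ {x} σ₁ - hamiltonianTsum Φ {x} σ₂) -
        (hamiltonianTsum Φ {x} σ₃ - hamiltonianTsum Φ {x} σ₄)| ≤
      2 * ∑' B : Finset V, if x ∈ B ∧ y ∈ B then δ B else 0 := by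
  haveI : Nonempty (V → S) := ⟨σ₁⟩
  have hδ0 : ∀ B, 0 ≤ δ B := fun B => (abs_nonneg _).trans (hδ B σ₁ σ₁)
  have hS1 := summable_hamiltonianTsum h {x} σ₁
  have hS2 := summable_hamiltonianTsum h {x} σ₂
  have hS3 := summable_hamiltonianTsum h {x} σ₃
  have hS4 := summable_hamiltonianTsum h {x} σ₄
  have hPb := h.summable_pair x y
  have hP : Summable fun B : Finset V => if x ∈ B ∧ y ∈ B then δ B else 0 := by
    refine Summable.of_nonneg_of_le (fun B => ?_) (fun B => ?_) (hPb.mul_left 2)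
    · split_ifs
      exacts [hδ0 B, le_rfl]
    · split_ifs
      · exact hδb B
      · simp
  unfold hamiltonianTsum
  rw [← hS1.tsum_sub hS2, ← hS3.tsum_sub hS4, ← (hS1.sub hS2).tsum_sub (hS3.sub hS4),
    ← tsum_mul_left]
  have hxB : ∀ B : Finset V, (B ∩ {x}).Nonempty ↔ x ∈ B := fun B => by simp [Finset.Nonempty]
  have hterm : ∀ B : Finset V,
      ‖((if (B ∩ {x}).Nonempty then Φ B σ₁ else 0) - (if (B ∩ {x}).Nonempty then Φ B σ₂ else 0)) -
        ((if (B ∩ {x}).Nonempty then Φ B σ₃ else 0) - (if (B ∩ {x}).Nonempty then Φ B σ₄ else 0))‖ ≤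
        2 * (if x ∈ B ∧ y ∈ B then δ B else 0) := by
    intro B
    rw [Real.norm_eq_abs]
    by_cases hx : x ∈ B
    · simp only [if_pos ((hxB B).2 hx)]
      by_cases hy : y ∈ B
      · rw [if_pos ⟨hx, hy⟩]
        calc |Φ B σ₁ - Φ B σ₂ - (Φ B σ₃ - Φ B σ₄)| = |(Φ B σ₁ - Φ B σ₃) - (Φ B σ₂ - Φ B σ₄)| := by
              ring_nf
          _ ≤ |Φ B σ₁ - Φ B σ₃| + |Φ B σ₂ - Φ B σ₄| := abs_sub _ _
          _ ≤ δ B + δ B := add_le_add (hδ B σ₁ σ₃) (hδ B σ₂ σ₄)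
          _ = 2 * δ B := by ring
      · rw [if_neg (fun h' => hy h'.2)]
        have e12 : Φ B σ₁ = Φ B σ₂ := (hΦ B).1 fun i hi => h12 i (by
          rintro rfl
          exact hy (Finset.mem_coe.1 hi))
        have e34 : Φ B σ₃ = Φ B σ₄ := (hΦ B).1 fun i hi => h34 i (by
          rintro rfl
          exact hy (Finset.mem_coe.1 hi))
        simp [e12, e34]
    · have hn : ¬ (B ∩ {x}).Nonempty := fun h' => hx ((hxB B).1 h')
      simp only [if_neg hn, if_neg (show ¬ (x ∈ B ∧ y ∈ B) from fun h' => hx h'.1)]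
      simp
  have hsum : Summable fun B : Finset V =>
      ‖((if (B ∩ {x}).Nonempty then Φ B σ₁ else 0) - (if (B ∩ {x}).Nonempty then Φ B σ₂ else 0)) -
        ((if (B ∩ {x}).Nonempty then Φ B σ₃ else 0) - (if (B ∩ {x}).Nonempty then Φ B σ₄ else 0))‖ :=
    Summable.of_nonneg_of_le (fun _ => norm_nonneg _) hterm (hP.mul_left 2)
  calc |∑' B : Finset V, (((if (B ∩ {x}).Nonempty then Φ B σ₁ else 0) -
          (if (B ∩ {x}).Nonempty then Φ B σ₂ else 0)) -
          ((if (B ∩ {x}).Nonempty then Φ B σ₃ else 0) - (if (B ∩ {x}).Nonempty then Φ B σ₄ else 0)))|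
        = ‖∑' B : Finset V, (((if (B ∩ {x}).Nonempty then Φ B σ₁ else 0) -
          (if (B ∩ {x}).Nonempty then Φ B σ₂ else 0)) -
          ((if (B ∩ {x}).Nonempty then Φ B σ₃ else 0) -
            (if (B ∩ {x}).Nonempty then Φ B σ₄ else 0)))‖ := (Real.norm_eq_abs _).symm
    _ ≤ _ := norm_tsum_le_tsum_norm hsum
    _ ≤ _ := Summable.tsum_le_tsum hterm hsum (hP.mul_left 2)

/-- **Sitewise leg, oscillation form** (Simon 1979, Remarks 1–2 p. 185; Georgii 2011, Prop. 8.8;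
Friedli–Velenik 2017, proof of Thm. 6.35): if `δ B` bounds the oscillation of `Φ_B` (w.l.o.g.
`δ B ≤ 2 b B`) and `ω = η` off `y`, then for every bounded measurable `φ` of oscillation `≤ L`,
`|γ_x(φ | ω) − γ_x(φ | η)| ≤ ½ |β| (∑_{B ∋ x, y} δ B) · L` (centre the energy difference, then
Simon's lemma). [cite: Simon1979Dobrushin, Remarks 1–2] -/
theorem abs_integral_siteLaw_sub_le_of_eq_off_osc [Countable V] (ν : Measure S)
    [IsProbabilityMeasure ν] (hΦ : Φ.IsAdapted) (hb : Φ.HasSummableBound b)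
    (hδ : ∀ B σ σ', |Φ B σ - Φ B σ'| ≤ δ B) (hδb : ∀ B, δ B ≤ 2 * b B) (β : ℝ) (x y : V)
    {ω η : V → S} (hoff : ∀ z, z ≠ y → ω z = η z) {φ : S → ℝ} {L : ℝ} (hφm : Measurable φ)
    (hφb : ∃ M, ∀ s, |φ s| ≤ M) (hφ : ∀ a c, |φ a - φ c| ≤ L) :
    |∫ s, φ s ∂(DobrushinMetric.siteLaw (gibbsSpecOfSummablePotential ν Φ β) x ω) -
        ∫ s, φ s ∂(DobrushinMetric.siteLaw (gibbsSpecOfSummablePotential ν Φ β) x η)| ≤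
      (|β| / 2 * ∑' B : Finset V, if x ∈ B ∧ y ∈ B then δ B else 0) * L := by
  rw [siteLaw_gibbsSpecOfSummablePotential ν hΦ hb β x ω,
    siteLaw_gibbsSpecOfSummablePotential ν hΦ hb β x η]
  have hHm : Measurable (hamiltonianTsum Φ {x}) :=
    measurable_hamiltonianTsum (fun B => (hΦ B).2) hb {x}
  have hm : ∀ ζ : V → S, Measurable fun s : S => -β * hamiltonianTsum Φ {x} (Function.update ζ x s) :=
    fun ζ => (hHm.comp (measurable_update ζ)).const_mul _
  have hbd : ∀ ζ : V → S, ∃ B, ∀ s : S, |-β * hamiltonianTsum Φ {x} (Function.update ζ x s)| ≤ B := by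
    intro ζ
    refine ⟨|β| * ∑' B : Finset V, (if (B ∩ {x}).Nonempty then b B else 0), fun s => ?_⟩
    rw [abs_mul, abs_neg]
    exact mul_le_mul_of_nonneg_left (abs_hamiltonianTsum_le hb {x} _) (abs_nonneg β)
  -- the energy difference and its centring constant
  have hagree : ∀ s : S, ∀ z, z ≠ y → Function.update ω x s z = Function.update η x s z := by
    intro s z hz
    by_cases hzx : z = x
    · subst hzx
      simp
    · rw [Function.update_of_ne hzx, Function.update_of_ne hzx, hoff z hz]
  set G : S → ℝ := fun s =>
    hamiltonianTsum Φ {x} (Function.update ω x s) - hamiltonianTsum Φ {x} (Function.update η x s)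
    with hG
  have hGb : ∃ M, ∀ s, |G s| ≤ M :=
    ⟨2 * ∑' B : Finset V, (if x ∈ B ∧ y ∈ B then b B else 0), fun s =>
      abs_hamiltonianTsum_singleton_sub_le hΦ hb x y (hagree s)⟩
  have hGosc : ∀ s s', |G s - G s'| ≤ 2 * ∑' B : Finset V, if x ∈ B ∧ y ∈ B then δ B else 0 :=
    fun s s' => abs_hamiltonianTsum_singleton_sub_sub_le hΦ hb hδ hδb x y (hagree s) (hagree s')
  obtain ⟨m, hm'⟩ := DobrushinMetric.exists_forall_abs_sub_le_half hGb hGosc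
  have key := DobrushinMetric.abs_integral_tilted_sub_integral_tilted_le_linear ν (hm ω) (hm η)
    (hbd ω) (hbd η) (κ := -β * m)
    (ε := |β| * ∑' B : Finset V, if x ∈ B ∧ y ∈ B then δ B else 0) (fun s => ?_) hφm hφb hφ
  · refine key.trans_eq ?_
    ring
  · have e : -β * hamiltonianTsum Φ {x} (Function.update ω x s) -
        -β * hamiltonianTsum Φ {x} (Function.update η x s) - -β * m = -β * (G s - m) := by
      simp only [hG]; ring
    rw [e, abs_mul, abs_neg]
    refine mul_le_mul_of_nonneg_left ?_ (abs_nonneg β)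
    have := hm' s
    linarith

open scoped Classical in
/-- **Dobrushin uniqueness at high temperature, oscillation form** (Georgii 2011, Prop. 8.8; Simon 1979,
Theorem with Remarks 1–2; Friedli–Velenik 2017, Thm. 6.35): if `δ B` bounds the oscillation of
`Φ_B` (w.l.o.g. `δ B ≤ 2 b B`) and `sup_x ∑_{y ≠ x} ½ |β| Dδ_{xy} ≤ c < 1`,
`Dδ_{xy} := ∑_{B ∋ x, y} δ B`, then `gibbsSpecOfSummablePotential ν Φ β` admits at most one
Gibbs measure. [cite: Simon1979Dobrushin, Theorem and Remarks 1–2] -/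
theorem subsingleton_gibbsMeasures_gibbsSpecOfSummablePotential_osc [Countable V]
    [MeasurableSingletonClass S] [PseudoMetricSpace S] [BorelSpace S] [Nonempty S]
    (ν : Measure S) [IsProbabilityMeasure ν] (hΦ : Φ.IsAdapted) (hb : Φ.HasSummableBound b)
    (hδ : ∀ B σ σ', |Φ B σ - Φ B σ'| ≤ δ B) (hδb : ∀ B, δ B ≤ 2 * b B)
    (β : ℝ) {A : ℝ} (hA0 : 0 ≤ A) (hA : ∀ a c : S, dist a c ≤ A) (D : V → V → ℝ)
    (hD : ∀ x y, HasSum (fun B : Finset V => if x ∈ B ∧ y ∈ B then δ B else 0) (D x y))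
    {c : ℝ} (hc0 : 0 ≤ c) (hc1 : c < 1)
    (hs : ∀ x, Summable fun y => if y = x then (0 : ℝ) else |β| / 2 * D x y)
    (hrow : ∀ x, ∑' y, (if y = x then (0 : ℝ) else |β| / 2 * D x y) ≤ c) :
    (gibbsMeasures (gibbsSpecOfSummablePotential ν Φ β)).Subsingleton := by
  have hγ := isSpecification_gibbsSpecOfSummablePotential ν hΦ hb β
  haveI : Nonempty (V → S) := ⟨fun _ => Classical.arbitrary S⟩
  have hδ0 : ∀ B, 0 ≤ δ B := fun B => (abs_nonneg _).trans (hδ B (Classical.arbitrary _)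
    (Classical.arbitrary _))
  have hD0 : ∀ x y, 0 ≤ D x y := fun x y =>
    (hD x y).nonneg fun B => by
      split_ifs
      exacts [hδ0 B, le_rfl]
  have hDeq : ∀ x y, ∑' B : Finset V, (if x ∈ B ∧ y ∈ B then δ B else 0) = D x y :=
    fun x y => (hD x y).tsum_eq
  set C : V → V → ℝ := fun x y => if y = x then (0 : ℝ) else |β| / 2 * D x y with hC
  have hC0 : ∀ x y, 0 ≤ C x y := fun x y => by
    simp only [hC]
    split_ifs
    · exact le_rfl
    · exact mul_nonneg (div_nonneg (abs_nonneg β) two_pos.le) (hD0 x y)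
  refine DobrushinMetric.subsingleton_gibbsMeasures_of_summable_tv hγ hA0 hA hC0 hs
    (fun x ω η φ L hφm hφb hL hφ => ?_) hc0 hc1 hrow
  refine DobrushinMetric.global_of_sitewise_of_quasilocal
    (r := fun a c : S => if a = c then (0 : ℝ) else 1) (R := 1)
    (fun a c => by split_ifs <;> norm_num) (fun a c => by split_ifs <;> norm_num) hC0 hs x
    (fun y ω' η' hoff ψ L' hψm hψb hL' hψ => ?_)
    (fun M L' ε hε => siteLaw_gibbsSpecOfSummablePotential_quasilocal ν hΦ hb β x M L' ε hε)
    ω η φ L hφm hφb hL (fun a c => by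
      by_cases hac : a = c
      · subst hac; simp
      · simpa [hac] using hφ a c)
  have hψ' : ∀ a c, |ψ a - ψ c| ≤ L' := fun a c => by
    by_cases hac : a = c
    · subst hac; simp [hL']
    · simpa [hac] using hψ a c
  by_cases hωη : ω' y = η' y
  · have : ω' = η' := funext fun z => by
      by_cases hz : z = y
      · subst hz; exact hωη
      · exact hoff z hz
    subst this
    simp
  rw [if_neg hωη, mul_one]
  by_cases hyx : y = x
  · subst hyx
    rw [DobrushinMetric.siteLaw_congr_of_eq_off' hγ y hoff, sub_self, abs_zero]
    exact mul_nonneg (hC0 y y) hL'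
  · have hleg := abs_integral_siteLaw_sub_le_of_eq_off_osc ν hΦ hb hδ hδb β x y hoff hψm hψb hψ'
    rw [hDeq x y] at hleg
    have hCxy : C x y = |β| / 2 * D x y := by simp [hC, hyx]
    rw [hCxy]
    exact hleg

open scoped Classical in
/-- **Georgii's high-temperature criterion** (Georgii 2011, Prop. 8.8:
`sup_x ∑_{A ∋ x} (|A| − 1) δ(Φ_A) < 2` implies Dobrushin's condition; Simon 1979, Theorem with
Remarks 1–2; Friedli–Velenik 2017, Thm. 6.35 with (6.47), where `< 1` is required in the un-halved
normalisation): if `δ B` bounds the oscillation of `Φ_B` (w.l.o.g. `δ B ≤ 2 b B`) and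
`sup_x ½ |β| ∑_{B ∋ x} (|B| − 1) δ B ≤ c < 1`, then `gibbsSpecOfSummablePotential ν Φ β` admits at
most one Gibbs measure. [cite: Georgii2011, Prop. 8.8] [cite: Simon1979Dobrushin, Remarks 1–2] -/
theorem subsingleton_gibbsMeasures_gibbsSpecOfSummablePotential_georgii [Countable V]
    [MeasurableSingletonClass S] [PseudoMetricSpace S] [BorelSpace S] [Nonempty S]
    (ν : Measure S) [IsProbabilityMeasure ν] (hΦ : Φ.IsAdapted) (hb : Φ.HasSummableBound b)
    (hδ : ∀ B σ σ', |Φ B σ - Φ B σ'| ≤ δ B) (hδb : ∀ B, δ B ≤ 2 * b B)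
    (β : ℝ) {A : ℝ} (hA0 : 0 ≤ A) (hA : ∀ a c : S, dist a c ≤ A) (K : V → ℝ)
    (hK : ∀ x, HasSum (fun B : Finset V => if x ∈ B then ((B.card : ℝ) - 1) * δ B else 0) (K x))
    {c : ℝ} (hc0 : 0 ≤ c) (hc1 : c < 1) (hrow : ∀ x, |β| / 2 * K x ≤ c) :
    (gibbsMeasures (gibbsSpecOfSummablePotential ν Φ β)).Subsingleton := by
  haveI : Nonempty (V → S) := ⟨fun _ => Classical.arbitrary S⟩
  have hδ0 : ∀ B, 0 ≤ δ B := fun B => (abs_nonneg _).trans (hδ B (Classical.arbitrary _)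
    (Classical.arbitrary _))
  have hPδ : ∀ x y, Summable fun B : Finset V => if x ∈ B ∧ y ∈ B then δ B else 0 := by
    intro x y
    refine Summable.of_nonneg_of_le (fun B => ?_) (fun B => ?_) ((hb.summable_pair x y).mul_left 2)
    · split_ifs
      exacts [hδ0 B, le_rfl]
    · split_ifs
      · exact hδb B
      · simp
  set D : V → V → ℝ := fun x y => ∑' B : Finset V, if x ∈ B ∧ y ∈ B then δ B else 0 with hDdef
  have hD : ∀ x y, HasSum (fun B : Finset V => if x ∈ B ∧ y ∈ B then δ B else 0) (D x y) :=
    fun x y => (hPδ x y).hasSum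
  have hpair : ∀ x, HasSum (fun y : V => if y = x then (0 : ℝ) else D x y) (K x) :=
    fun x => hasSum_pairMajorant_eq_card_sub_one hδ0 x (hK x)
  have hpairβ : ∀ x, HasSum (fun y : V => if y = x then (0 : ℝ) else |β| / 2 * D x y)
      (|β| / 2 * K x) := by
    intro x
    have h := (hpair x).mul_left (|β| / 2)
    simp only [mul_ite, mul_zero] at h
    exact h
  exact subsingleton_gibbsMeasures_gibbsSpecOfSummablePotential_osc ν hΦ hb hδ hδb β hA0 hA D hD
    hc0 hc1 (fun x => (hpairβ x).summable) (fun x => by rw [(hpairβ x).tsum_eq]; exact hrow x)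

end Oscillation

end Literature.Probability.LatticeModels
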